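import Summits.CriticalPhenomena.Ising3DConformalLimit.Theorems.SynchronousCouplingRotationJoiningIsotropyMoments
import Summits.CriticalPhenomena.Ising3DConformalLimit.Theorems.SynchronousCouplingRotationJoiningRateBootstrap
import Summits.CriticalPhenomena.Ising3DConformalLimit.Theorems.HyperoctahedralRPExistsScaleCovariantLimitBlockCovAlgebra
import HarnessLib

/-!
# Route `SynchronousCoupling`, crux `RotationJoining` (stmt-CriticalPhenomena-18763), line `SketchIdeator2`
(reshape 2): tools for `stub_tiltedTransfer` — squared `L²` bookkeeping and lattice second moments

First tools file of the stub `stub_tiltedTransfer` (`TiltedTransfer`: dilation joinings for TILTED cells from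
those for axis cells). Elementary, no named facts:

* squared `L²` bookkeeping for bounded measurable real functions on a finite measure space:
  `∫ (f+g)² ≤ 2(∫f² + ∫g²)`, `∫ (f+g+h)² ≤ 3(…)`, `∫ (Σᵢ fᵢ)² ≤ #s · Σᵢ ∫ fᵢ²` (Cauchy–Schwarz pointwise),
  `∫ (c f)² = c² ∫ f²`, the squared reverse triangle inequality `(√∫f² − √∫g²)² ≤ ∫ (f−g)²`
  (from Minkowski `sqrt_integral_sq_sub_le` of `…RotationJoiningL2Gluing`), and the transfer of integrals of
  one-coordinate observables from a coupling to its marginals;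
* the second-moment dictionary of the critical state: every `μ ∈ 𝒢(β_c(3), 0)` is the plus state
  (`criticalState_of_mem'` of `…IsotropyMoments`), so
  `∫ (Σ_{x∈P} σ_x)² dμ = Σ_{x,y∈P} ⟨σ₀σ_{y−x}⟩_{β_c}` (`criticalCorr_eq_integral_spinMonomial`, `criticalCorr_two_pair`);
  these pair sums are `≥ 0`, monotone in `P`, translation invariant, equal to the block variance `V(n) = blockCov n 0`
  on axis cells, and bounded by `#P · Σ_{z ∈ box R} ⟨σ₀σ_z⟩` when all differences of `P` lie in `box 3 R`;
* consequences of `TiltGeometry` for tilted cells: differences lie in `box 3 (2n)`, the pair sum of the `u = 0`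
  tilted cell dominates `V(⌊n/3⌋)`, and the block sum of a tilted cell splits into the block sums of the fine axis
  cells it contains plus the block sum of the remainder.

Registered sub-goal carried here: `tiltedTransfer_secondMoment`.
-/

noncomputable section

namespace Summit.CriticalPhenomena.Ising3DConformalLimit.Cruxes.RotationJoining.RateSplitting

open MeasureTheory Literature.Probability.LatticeModels
open Summit.CriticalPhenomena.Ising3DConformalLimit.Cruxes.ExistsScaleCovariantLimit.MonotoneBlockingPort

/-! ### Squared `L²` bookkeeping on a finite measure space -/

section L2

variable {α : Type*} [MeasurableSpace α] (μ : Measure α)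

/-- `∫ (c f)² = c² ∫ f²` (no integrability needed). -/
theorem integral_const_mul_sq (c : ℝ) (f : α → ℝ) :
    ∫ x, (c * f x) ^ 2 ∂μ = c ^ 2 * ∫ x, (f x) ^ 2 ∂μ := by
  simp_rw [mul_pow]
  exact integral_const_mul _ _

/-- A finite sum of bounded real functions is bounded. -/
theorem bounded_finset_sum {β ι : Type*} (s : Finset ι) {f : ι → β → ℝ} (hb : ∀ i, ∃ B, ∀ x, |f i x| ≤ B) :
    ∃ B, ∀ x, |∑ i ∈ s, f i x| ≤ B := by
  choose B hB using hb
  exact ⟨∑ i ∈ s, B i, fun x => (Finset.abs_sum_le_sum_abs _ _).trans (Finset.sum_le_sum fun i _ => hB i x)⟩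

variable [IsFiniteMeasure μ]

/-- The square of a bounded measurable function is integrable (finite measure). -/
theorem integrable_sq_of_bounded {f : α → ℝ} (hf : Measurable f) (hb : ∃ B, ∀ x, |f x| ≤ B) :
    Integrable (fun x => (f x) ^ 2) μ := by
  obtain ⟨B, hB⟩ := hb
  refine integrable_of_measurable_of_abs_le μ (hf.pow_const 2) (B := B ^ 2) fun x => ?_
  rw [abs_pow]
  exact pow_le_pow_left₀ (abs_nonneg _) (hB x) 2

/-- `∫ (f+g)² ≤ 2 (∫ f² + ∫ g²)` for bounded measurable `f, g`. -/
theorem integral_add_sq_le {f g : α → ℝ} (hf : Measurable f) (hg : Measurable g)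
    (hfb : ∃ B, ∀ x, |f x| ≤ B) (hgb : ∃ B, ∀ x, |g x| ≤ B) :
    ∫ x, (f x + g x) ^ 2 ∂μ ≤ 2 * (∫ x, (f x) ^ 2 ∂μ + ∫ x, (g x) ^ 2 ∂μ) := by
  have hI := integrable_sq_of_bounded μ hf hfb
  have hJ := integrable_sq_of_bounded μ hg hgb
  calc ∫ x, (f x + g x) ^ 2 ∂μ ≤ ∫ x, 2 * ((f x) ^ 2 + (g x) ^ 2) ∂μ := by
        refine integral_mono_of_nonneg (ae_of_all _ fun x => sq_nonneg _) ((hI.add hJ).const_mul 2)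
          (ae_of_all _ fun x => ?_)
        nlinarith [sq_nonneg (f x - g x)]
    _ = 2 * (∫ x, (f x) ^ 2 ∂μ + ∫ x, (g x) ^ 2 ∂μ) := by rw [integral_const_mul, integral_add hI hJ]

/-- `∫ (f−g)² ≤ 2 (∫ f² + ∫ g²)` for bounded measurable `f, g`. -/
theorem integral_sub_sq_le {f g : α → ℝ} (hf : Measurable f) (hg : Measurable g)
    (hfb : ∃ B, ∀ x, |f x| ≤ B) (hgb : ∃ B, ∀ x, |g x| ≤ B) :
    ∫ x, (f x - g x) ^ 2 ∂μ ≤ 2 * (∫ x, (f x) ^ 2 ∂μ + ∫ x, (g x) ^ 2 ∂μ) := by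
  have hI := integrable_sq_of_bounded μ hf hfb
  have hJ := integrable_sq_of_bounded μ hg hgb
  calc ∫ x, (f x - g x) ^ 2 ∂μ ≤ ∫ x, 2 * ((f x) ^ 2 + (g x) ^ 2) ∂μ := by
        refine integral_mono_of_nonneg (ae_of_all _ fun x => sq_nonneg _) ((hI.add hJ).const_mul 2)
          (ae_of_all _ fun x => ?_)
        nlinarith [sq_nonneg (f x + g x)]
    _ = 2 * (∫ x, (f x) ^ 2 ∂μ + ∫ x, (g x) ^ 2 ∂μ) := by rw [integral_const_mul, integral_add hI hJ]

/-- `∫ (f+g+h)² ≤ 3 (∫ f² + ∫ g² + ∫ h²)` for bounded measurable `f, g, h`. -/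
theorem integral_add_add_sq_le {f g h : α → ℝ} (hf : Measurable f) (hg : Measurable g) (hh : Measurable h)
    (hfb : ∃ B, ∀ x, |f x| ≤ B) (hgb : ∃ B, ∀ x, |g x| ≤ B) (hhb : ∃ B, ∀ x, |h x| ≤ B) :
    ∫ x, (f x + g x + h x) ^ 2 ∂μ ≤
      3 * (∫ x, (f x) ^ 2 ∂μ + ∫ x, (g x) ^ 2 ∂μ + ∫ x, (h x) ^ 2 ∂μ) := by
  have hI := integrable_sq_of_bounded μ hf hfb
  have hJ := integrable_sq_of_bounded μ hg hgb
  have hK := integrable_sq_of_bounded μ hh hhb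
  have hIJ : Integrable (fun x => (f x) ^ 2 + (g x) ^ 2) μ := hI.add hJ
  calc ∫ x, (f x + g x + h x) ^ 2 ∂μ ≤ ∫ x, 3 * ((f x) ^ 2 + (g x) ^ 2 + (h x) ^ 2) ∂μ := by
        refine integral_mono_of_nonneg (ae_of_all _ fun x => sq_nonneg _) (((hI.add hJ).add hK).const_mul 3)
          (ae_of_all _ fun x => ?_)
        nlinarith [sq_nonneg (f x - g x), sq_nonneg (g x - h x), sq_nonneg (f x - h x)]
    _ = 3 * (∫ x, (f x) ^ 2 ∂μ + ∫ x, (g x) ^ 2 ∂μ + ∫ x, (h x) ^ 2 ∂μ) := by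
        rw [integral_const_mul, integral_add hIJ hK, integral_add hI hJ]

/-- `∫ (Σ_{i∈s} fᵢ)² ≤ #s · Σ_{i∈s} ∫ fᵢ²` for bounded measurable `fᵢ` (Cauchy–Schwarz pointwise). -/
theorem integral_sum_sq_le {ι : Type*} (s : Finset ι) {f : ι → α → ℝ} (hf : ∀ i, Measurable (f i))
    (hb : ∀ i, ∃ B, ∀ x, |f i x| ≤ B) :
    ∫ x, (∑ i ∈ s, f i x) ^ 2 ∂μ ≤ s.card * ∑ i ∈ s, ∫ x, (f i x) ^ 2 ∂μ := by
  have hI : ∀ i, Integrable (fun x => (f i x) ^ 2) μ := fun i => integrable_sq_of_bounded μ (hf i) (hb i)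
  calc ∫ x, (∑ i ∈ s, f i x) ^ 2 ∂μ ≤ ∫ x, s.card * ∑ i ∈ s, (f i x) ^ 2 ∂μ :=
        integral_mono_of_nonneg (ae_of_all _ fun x => sq_nonneg _)
          ((integrable_finsetSum s fun i _ => hI i).const_mul _)
          (ae_of_all _ fun x => sq_sum_le_card_mul_sum_sq)
    _ = s.card * ∑ i ∈ s, ∫ x, (f i x) ^ 2 ∂μ := by
        rw [integral_const_mul, integral_finsetSum s fun i _ => hI i]

/-- Squared reverse triangle inequality in `L²`: `(√∫f² − √∫g²)² ≤ ∫ (f−g)²` for bounded measurable `f, g`. -/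
theorem sq_sqrt_integral_sq_sub_le {f g : α → ℝ} (hf : Measurable f) (hg : Measurable g)
    (hfb : ∃ B, ∀ x, |f x| ≤ B) (hgb : ∃ B, ∀ x, |g x| ≤ B) :
    (Real.sqrt (∫ x, (f x) ^ 2 ∂μ) - Real.sqrt (∫ x, (g x) ^ 2 ∂μ)) ^ 2 ≤ ∫ x, (f x - g x) ^ 2 ∂μ := by
  have h0 : ∃ B, ∀ _x : α, |(0 : ℝ)| ≤ B := ⟨0, fun _ => by simp⟩
  have h1 := sqrt_integral_sq_sub_le μ (c := fun _ => (0 : ℝ)) hf hg measurable_const hfb hgb h0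
  have h2 := sqrt_integral_sq_sub_le μ (c := fun _ => (0 : ℝ)) hg hf measurable_const hgb hfb h0
  simp only [sub_zero] at h1 h2
  have hsymm : ∫ x, (g x - f x) ^ 2 ∂μ = ∫ x, (f x - g x) ^ 2 ∂μ := by
    refine integral_congr_ae (ae_of_all _ fun x => ?_)
    ring
  rw [hsymm] at h2
  have hD0 : 0 ≤ ∫ x, (f x - g x) ^ 2 ∂μ := integral_nonneg fun x => sq_nonneg _
  rw [← Real.sq_sqrt hD0]
  exact sq_le_sq' (by linarith) (by linarith)

end L2

/-- Transfer of a first-coordinate observable from a coupling to its first marginal. -/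
theorem integral_sq_comp_fst {Ω : Type*} [MeasurableSpace Ω] {π : Measure (Ω × Ω)} {μ : Measure Ω}
    (h : π.fst = μ) {φ : Ω → ℝ} (hφ : Measurable φ) : ∫ q, (φ q.1) ^ 2 ∂π = ∫ x, (φ x) ^ 2 ∂μ := by
  rw [← h, Measure.fst, integral_map measurable_fst.aemeasurable (hφ.pow_const 2).aestronglyMeasurable]

/-- Transfer of a second-coordinate observable from a coupling to its second marginal. -/
theorem integral_sq_comp_snd {Ω : Type*} [MeasurableSpace Ω] {π : Measure (Ω × Ω)} {μ : Measure Ω}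
    (h : π.snd = μ) {φ : Ω → ℝ} (hφ : Measurable φ) : ∫ q, (φ q.2) ^ 2 ∂π = ∫ x, (φ x) ^ 2 ∂μ := by
  rw [← h, Measure.snd, integral_map measurable_snd.aemeasurable (hφ.pow_const 2).aestronglyMeasurable]

/-- Measurability of a two-copy comparison observable `q ↦ a₁ X(q.1) − a₂ Y(q.2)`. -/
theorem measurable_mul_fst_sub_mul_snd {Ω : Type*} [MeasurableSpace Ω] {X Y : Ω → ℝ} (hX : Measurable X)
    (hY : Measurable Y) (a₁ a₂ : ℝ) : Measurable fun q : Ω × Ω => a₁ * X q.1 - a₂ * Y q.2 :=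
  ((hX.comp measurable_fst).const_mul a₁).sub ((hY.comp measurable_snd).const_mul a₂)

/-- Boundedness of a two-copy comparison observable `q ↦ a₁ X(q.1) − a₂ Y(q.2)`. -/
theorem bounded_mul_fst_sub_mul_snd {Ω : Type*} {X Y : Ω → ℝ} (hXb : ∃ B, ∀ σ, |X σ| ≤ B)
    (hYb : ∃ B, ∀ σ, |Y σ| ≤ B) (a₁ a₂ : ℝ) : ∃ B, ∀ q : Ω × Ω, |a₁ * X q.1 - a₂ * Y q.2| ≤ B := by
  obtain ⟨B, hB⟩ := hXb
  obtain ⟨C, hC⟩ := hYb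
  refine ⟨|a₁| * B + |a₂| * C, fun q => ?_⟩
  calc |a₁ * X q.1 - a₂ * Y q.2| ≤ |a₁ * X q.1| + |a₂ * Y q.2| := abs_sub _ _
    _ = |a₁| * |X q.1| + |a₂| * |Y q.2| := by rw [abs_mul, abs_mul]
    _ ≤ |a₁| * B + |a₂| * C := by gcongr; exacts [hB _, hC _]

/-! ### Second moments of block sums under the critical state -/

/-- A block sum is bounded (in the `∃ B` form). -/
theorem bounded_blockSum (S : Finset (Site 3)) : ∃ B : ℝ, ∀ σ : SpinConfig (Site 3), |blockSum S σ| ≤ B :=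
  ⟨S.card, abs_blockSum_le S⟩

/-- **Second-moment dictionary.** `∫ (Σ_{x∈P} σ_x)² dμ = Σ_{x,y∈P} ⟨σ₀σ_{y−x}⟩_{β_c}` for a finite measure with
the critical plus correlations. -/
theorem integral_blockSum_sq {μ : Measure (SpinConfig (Site 3))} [IsFiniteMeasure μ]
    (hc : ∀ A : Finset (Site 3), spinCorr μ A = plusCorr 3 (criticalBeta 3) 0 A) (P : Finset (Site 3)) :
    ∫ σ, (blockSum P σ) ^ 2 ∂μ = ∑ x ∈ P, ∑ y ∈ P, criticalTwoPoint 3 (y - x) := by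
  have hpt : ∀ σ, (blockSum P σ) ^ 2 = ∑ x ∈ P, ∑ y ∈ P, spinMonomial ![x, y] σ := by
    intro σ
    rw [blockSum, sq, Finset.sum_mul_sum]
    refine Finset.sum_congr rfl fun a _ => Finset.sum_congr rfl fun b _ => ?_
    simp [spinMonomial, Fin.prod_univ_two]
  have hint : ∀ y : Fin 2 → Site 3, Integrable (spinMonomial y) μ := fun y =>
    Integrable.of_bound (measurable_spinMonomial y).aestronglyMeasurable 1
      (Filter.Eventually.of_forall fun s => by
        rw [Real.norm_eq_abs]
        simp [spinMonomial])
  simp_rw [hpt]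
  rw [integral_finsetSum _ fun a _ => integrable_finsetSum _ fun b _ => hint ![a, b]]
  refine Finset.sum_congr rfl fun a _ => ?_
  rw [integral_finsetSum _ fun b _ => hint ![a, b]]
  refine Finset.sum_congr rfl fun b _ => ?_
  rw [← criticalCorr_eq_integral_spinMonomial hc ![a, b], criticalCorr_two_pair]

/-- **Registered sub-goal `tiltedTransfer_secondMoment`** (tool of `stub_tiltedTransfer`): under every critical
Gibbs measure the second moment of a block sum is the pair sum of critical two-point functions. -/
theorem tiltedTransfer_secondMoment :
    ∀ μ ∈ isingGibbsMeasures 3 (criticalBeta 3) 0, ∀ P : Finset (Site 3),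
      ∫ σ, (blockSum P σ) ^ 2 ∂μ = ∑ x ∈ P, ∑ y ∈ P, criticalTwoPoint 3 (y - x) := by
  intro μ hμ P
  obtain ⟨hP, hc⟩ := criticalState_of_mem' hμ
  exact integral_blockSum_sq hc P

/-- Pair sums are nonnegative (Griffiths). -/
theorem pairSum_nonneg (P : Finset (Site 3)) : 0 ≤ ∑ x ∈ P, ∑ y ∈ P, criticalTwoPoint 3 (y - x) :=
  Finset.sum_nonneg fun _ _ => Finset.sum_nonneg fun _ _ => criticalTwoPoint_nonneg' _

/-- Pair sums are monotone in the set. -/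
theorem pairSum_mono {P P' : Finset (Site 3)} (h : P ⊆ P') :
    ∑ x ∈ P, ∑ y ∈ P, criticalTwoPoint 3 (y - x) ≤ ∑ x ∈ P', ∑ y ∈ P', criticalTwoPoint 3 (y - x) :=
  calc ∑ x ∈ P, ∑ y ∈ P, criticalTwoPoint 3 (y - x) ≤ ∑ x ∈ P, ∑ y ∈ P', criticalTwoPoint 3 (y - x) :=
        Finset.sum_le_sum fun _ _ => Finset.sum_le_sum_of_subset_of_nonneg h fun _ _ _ => criticalTwoPoint_nonneg' _
    _ ≤ ∑ x ∈ P', ∑ y ∈ P', criticalTwoPoint 3 (y - x) :=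
        Finset.sum_le_sum_of_subset_of_nonneg h fun _ _ _ => Finset.sum_nonneg fun _ _ => criticalTwoPoint_nonneg' _

/-- Pair sums dominate the cardinality (the diagonal terms are `⟨σ₀σ₀⟩ = 1`). -/
theorem card_le_pairSum (P : Finset (Site 3)) : (P.card : ℝ) ≤ ∑ x ∈ P, ∑ y ∈ P, criticalTwoPoint 3 (y - x) := by
  have h : ∀ x ∈ P, (1 : ℝ) ≤ ∑ y ∈ P, criticalTwoPoint 3 (y - x) := fun x hx => by
    have key := Finset.single_le_sum (f := fun y => criticalTwoPoint 3 (y - x))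
      (fun y _ => criticalTwoPoint_nonneg' _) hx
    simpa [criticalTwoPoint_zero'] using key
  calc (P.card : ℝ) = ∑ x ∈ P, (1 : ℝ) := by simp
    _ ≤ _ := Finset.sum_le_sum h

/-- Pair sums are at most the squared cardinality (`⟨σ₀σ_z⟩ ≤ 1`). -/
theorem pairSum_le_card_sq (P : Finset (Site 3)) :
    ∑ x ∈ P, ∑ y ∈ P, criticalTwoPoint 3 (y - x) ≤ (P.card : ℝ) ^ 2 :=
  calc ∑ x ∈ P, ∑ y ∈ P, criticalTwoPoint 3 (y - x) ≤ ∑ x ∈ P, ∑ y ∈ P, (1 : ℝ) :=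
        Finset.sum_le_sum fun _ _ => Finset.sum_le_sum fun _ _ => criticalTwoPoint_le_one' _
    _ = (P.card : ℝ) ^ 2 := by simp [sq]

/-- If all differences of `P` lie in `box 3 R`, the pair sum is at most `#P · Σ_{z ∈ box 3 R} ⟨σ₀σ_z⟩`. -/
theorem pairSum_le_card_mul_boxSum {P : Finset (Site 3)} {R : ℕ} (h : ∀ x ∈ P, ∀ y ∈ P, y - x ∈ box 3 R) :
    ∑ x ∈ P, ∑ y ∈ P, criticalTwoPoint 3 (y - x) ≤ P.card * ∑ z ∈ box 3 R, criticalTwoPoint 3 z := by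
  have key : ∀ x ∈ P, ∑ y ∈ P, criticalTwoPoint 3 (y - x) ≤ ∑ z ∈ box 3 R, criticalTwoPoint 3 z := by
    intro x hx
    have hinj : ∀ y ∈ P, ∀ y' ∈ P, y - x = y' - x → y = y' := fun y _ y' _ hyy' => sub_left_inj.mp hyy'
    rw [← Finset.sum_image (f := fun z => criticalTwoPoint 3 z) hinj]
    refine Finset.sum_le_sum_of_subset_of_nonneg (fun z hz => ?_) fun z _ _ => criticalTwoPoint_nonneg' z
    obtain ⟨y, hy, rfl⟩ := Finset.mem_image.1 hz
    exact h x hx y hy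
  calc ∑ x ∈ P, ∑ y ∈ P, criticalTwoPoint 3 (y - x) ≤ ∑ x ∈ P, ∑ z ∈ box 3 R, criticalTwoPoint 3 z :=
        Finset.sum_le_sum key
    _ = P.card * ∑ z ∈ box 3 R, criticalTwoPoint 3 z := by rw [Finset.sum_const, nsmul_eq_mul]

/-- Pair sums are translation invariant. -/
theorem pairSum_image_add (P : Finset (Site 3)) (c : Site 3) :
    ∑ x ∈ P.image (· + c), ∑ y ∈ P.image (· + c), criticalTwoPoint 3 (y - x) =
      ∑ x ∈ P, ∑ y ∈ P, criticalTwoPoint 3 (y - x) := by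
  have hinj : ∀ x ∈ P, ∀ y ∈ P, x + c = y + c → x = y := fun x _ y _ hxy => add_right_cancel hxy
  rw [Finset.sum_image hinj]
  refine Finset.sum_congr rfl fun x _ => ?_
  rw [Finset.sum_image hinj]
  refine Finset.sum_congr rfl fun y _ => ?_
  rw [add_sub_add_right_eq_sub]

/-- The pair sum of the `u = 0` axis cell is the block variance `V(n)`. -/
theorem pairSum_axisCell_zero (n : ℕ) :
    ∑ x ∈ axisCell n 0, ∑ y ∈ axisCell n 0, criticalTwoPoint 3 (y - x) = blockCov n 0 := by
  rw [blockCov_zero_eq, axisCell_zero']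
  rfl

/-- The axis cell at `u = (1,1,1)` is the translate of the one at `u = 0` by `(s,s,s)`. -/
theorem axisCell_one_eq_image (s : ℕ) :
    axisCell s (fun _ => 1) = (axisCell s 0).image (· + fun _ => (s : ℤ)) := by
  ext x
  simp only [axisCell, Fintype.mem_piFinset, Finset.mem_Ico, Finset.mem_image, Pi.zero_apply, mul_zero,
    zero_add, mul_one]
  constructor
  · intro hx
    refine ⟨x - fun _ => (s : ℤ), fun i => ?_, ?_⟩
    · have := hx i
      simp only [Pi.sub_apply]
      omega
    · funext i
      simp
  · rintro ⟨a, ha, rfl⟩ i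
    have := ha i
    simp only [Pi.add_apply]
    omega

/-- The pair sum of the axis cell at `u = (1,1,1)` is `V(s)` as well. -/
theorem pairSum_axisCell_one (s : ℕ) :
    ∑ x ∈ axisCell s (fun _ => 1), ∑ y ∈ axisCell s (fun _ => 1), criticalTwoPoint 3 (y - x) = blockCov s 0 := by
  rw [axisCell_one_eq_image, pairSum_image_add, pairSum_axisCell_zero]

/-- `normAxis μ n = (√V(n))⁻¹` for the critical state. -/
theorem normAxis_eq {μ : Measure (SpinConfig (Site 3))} [IsFiniteMeasure μ]
    (hc : ∀ A : Finset (Site 3), spinCorr μ A = plusCorr 3 (criticalBeta 3) 0 A) (n : ℕ) :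
    normAxis μ n = (Real.sqrt (blockCov n 0))⁻¹ := by
  rw [normAxis, integral_blockSum_sq hc, pairSum_axisCell_zero]

/-! ### Consequences of `TiltGeometry` -/

/-- Differences of two points of one tilted cell lie in `box 3 (2n)`; hence the pair sum of any `R ⊆ tiltCell n m u`
is at most `#R · Σ_{z ∈ box 3 (2n)} ⟨σ₀σ_z⟩`. -/
theorem pairSum_le_of_subset_tiltCell (hTG : TiltGeometry) {n m : ℕ} {u : Fin 3 → ℤ} {R : Finset (Site 3)}
    (hR : R ⊆ tiltCell n m u) :
    ∑ x ∈ R, ∑ y ∈ R, criticalTwoPoint 3 (y - x) ≤ R.card * ∑ z ∈ box 3 (2 * n), criticalTwoPoint 3 z := by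
  obtain ⟨-, -, -, -, -, -, -, -, h9, -⟩ := hTG
  refine pairSum_le_card_mul_boxSum fun x hx y hy => ?_
  rw [mem_box]
  intro i
  have h := h9 n m u y x (hR hy) (hR hx) i
  rw [abs_lt] at h
  simp only [Pi.sub_apply]
  push_cast
  exact ⟨h.1.le, h.2.le⟩

/-- `V(⌊n/3⌋)` is dominated by the pair sum of the `u = 0` tilted cell of side `n` (it contains the axis cube
`[s, 2s)³`, `s = ⌊n/3⌋`). -/
theorem blockCov_third_le_pairSum_tiltCell (hTG : TiltGeometry) (n m : ℕ) :
    blockCov (n / 3) 0 ≤ ∑ x ∈ tiltCell n m 0, ∑ y ∈ tiltCell n m 0, criticalTwoPoint 3 (y - x) := by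
  obtain ⟨-, -, -, -, -, -, h7, -⟩ := hTG
  rw [← pairSum_axisCell_one]
  exact pairSum_mono (h7 n m)

/-- The pair sum of the `u = 0` tilted cell of side `n ≥ 3` is positive. -/
theorem pairSum_tiltCell_pos (hTG : TiltGeometry) {n : ℕ} (hn : 3 ≤ n) (m : ℕ) :
    0 < ∑ x ∈ tiltCell n m 0, ∑ y ∈ tiltCell n m 0, criticalTwoPoint 3 (y - x) :=
  lt_of_lt_of_le (blockCov_zero_pos (n / 3) (by omega)) (blockCov_third_le_pairSum_tiltCell hTG n m)

/-- **Decomposition of a block sum.** If the axis `n`-cells at the indices `v ∈ I` (`n ≥ 1`, pairwise disjoint by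
`TiltGeometry`) lie in `T`, then `Σ_{x∈T} σ_x = Σ_{v∈I} Σ_{x ∈ axisCell n v} σ_x + Σ_{x ∈ T ∖ ⋃_v axisCell n v} σ_x`. -/
theorem blockSum_eq_sum_add_sdiff (hTG : TiltGeometry) {n : ℕ} (hn : 1 ≤ n) {I : Finset (Fin 3 → ℤ)}
    {T : Finset (Site 3)} (hsub : ∀ v ∈ I, axisCell n v ⊆ T) (σ : SpinConfig (Site 3)) :
    blockSum T σ = ∑ v ∈ I, blockSum (axisCell n v) σ + blockSum (T \ I.biUnion (axisCell n)) σ := by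
  obtain ⟨-, -, -, -, -, h6, -⟩ := hTG
  have hdisj : (I : Set (Fin 3 → ℤ)).PairwiseDisjoint (axisCell n) := fun v _ w _ hvw => h6 n v w hn hvw
  have hU : I.biUnion (axisCell n) ⊆ T := Finset.biUnion_subset.2 hsub
  unfold blockSum
  rw [← Finset.sum_sdiff hU, Finset.sum_biUnion hdisj, add_comm]

end Summit.CriticalPhenomena.Ising3DConformalLimit.Cruxes.RotationJoining.RateSplitting

end
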